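import Summits.QuantumFields.YangMills.Theorems.BalabanUVNodesN27LedgerSyncJoin

/-!
# BalabanUVNodes ∕ N27 — THE TERM-WISE SPINE ROAD END TO END AT THE DATUM: the K4 children's DECL columns + the K5 Link record + N20 ·
# N21 + E1∕E2 ⇒ binder B5 at `Hβ := DagBinding.EndpointExistence D.C.toB12` ⇒ the PRINT-FAITHFUL existence target
# `D.ym4_torus_continuum_limit_exists'` (any gauge group), and for (0.4)-data on `SU(N)` ALL FOUR print-faithful targets
# (cell `pub-ymgap`, HUMAN RULING D-0062 Track A, seat `pub-ymgap-dag-n27-a` g3; `--supports stmt-QuantumFields-19182`, count-neutral)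

WHY.  Files VI–XI stop at binder B5 = `T4ApexHybrid.HybridNE7Under D Hβ` (node N27's statement of record).  For the chair's ∕ writer's
citation this module records, BY NAME and with no new content, where B5 goes: at `Hβ := DagBinding.EndpointExistence D.C.toB12` (the form of
record), `T4ApexHybrid.limit_exists'_of_hybridNE7Under'` turns B5 into the print-faithful existence target of the finite-ε datum (under (B)
pinned and endpoint existence, for all small γ, g and every tuned bare sequence: the continuum limit of every joint expectation of unit-scale
loop variables exists), and for (0.4)-data on `SU(N)` (`D.IsBlockAveraged ℰ`, measurable small-loop average) `targets'_of_hybridNE7Under'` gives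
existence ∧ uniqueness ∧ reflection positivity ∧ torus covariance of the limit.  So the TERM-WISE spine road reads END TO END: the children's
decls of record N16 · N17 (+ node U2's moduli + one printed-type β bound) · N18 · N22 · N19's Link (`LedgerAt`; the `LedgerAtSync` twin is the same
line over XI §3) · N20 · N21 · the E1∕E2 dictionary · the printed-grade brackets ⇒ the (B)+END-conditional UV statement on ONE finite torus.

WHAT IS KERNEL-CHECKED ([bookkeeping] ∕ [folklore]; 0 `def`, 0 `sorry`).
* `limit_exists'_of_declColumns_tail` — IX §3 at `Hβ := END` + `D.AvgMeasurable` ⇒ `D.ym4_torus_continuum_limit_exists'`.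
* `targets'_of_declColumns_tail` — the same for (0.4)-data on `SU(N)` ⇒ the four print-faithful targets.

HONEST FRAMING.  Composition of landed theorems BY NAME; every analytic input is a HYPOTHESIS SHAPE (NE3∕NE4∕NE5∕NE9∕NE7b∕NE7c none printed
for Bałaban's d = 4 procedure, none proved; `LedgerAt` = NODE O content; E1∕E2 = the class expansion at the record, not constructed); (B)
pinned and endpoint existence are ANTECEDENTS inside the targets, used, never discharged here; nothing of Bałaban's objects is instantiated;
NO node is discharged; ONE fixed finite four-torus at fixed `ε → 0` bookkeeping — NOT ℝ⁴, NOT infinite volume, NOT the OS axioms, NOT a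
mass gap, NOT Clay.  Typed 28∕28; the discharged count is not touched by this file.  No decl below carries a cite tag.
-/

open Finset MeasureTheory

namespace Summit.QuantumFields.YangMills.Theorems.BalabanUVNodesN27SpineRecord

open Literature.MathematicalPhysics.QuantumFieldTheory.Balaban1983to89
open Literature.MathematicalPhysics.QuantumFieldTheory.Balaban1983to89.FlowStep (HBeta BetaUpperH)
open Literature.MathematicalPhysics.QuantumFieldTheory.Balaban1983to89.T4CouplingMatching (ScaleShiftRate HistLipschitz)
open Literature.MathematicalPhysics.QuantumFieldTheory.Balaban1983to89.T4Continuum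
open T4OutputRate T4RecentScale T4GoodClassBudget T4CauchySum T4TowerRateComposition T4TowerRateDischarge T4TermwiseBudget
open T4WeightBudget (RelWeightBound)
open T4IndicatorShell (ShellWeightBound)
open T4EtaRateMin (Readings NE3Shape)
open T4RateLiaison (GaugeDominated)
open T4FlagMemory (extd)
open FlowStep (prefixOf)
open Summit.QuantumFields.BalabanUV.T4Continuum.Spine
open Summit.QuantumFields.BalabanUV.T4Continuum.Spine.NE4 (NE4OnData runFlow)
open Summit.QuantumFields.YangMills.BalabanUVNodes.N19SizeWindow (LedgerData LedgerAt)

/-! ## §1 Any gauge group: the print-faithful existence target -/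

section Existence

variable {F : T4Family} {G : Type*} [GaugeGroup G] [MeasurableSpace G] [RegularGaugeGroup G] [HaarData G]
  {C : Carriers} {ι X : Type} [MeasurableSpace ι]
  {R : Readings ι X} {Wset : Set (ℕ → ℝ)} {EA : Functional C C.BgA} {EB : Functional C C.BgB}
  {κ θ₅ C₅ C₉ ω C₃ θ₃ P γu : ℝ} {q : ℕ} {Λm : ℕ → ℕ → ℝ} {CU : (ℕ → ℝ) → ℕ → ℝ}
  {uA : ℕ → ι → C.BgA} {uB : ℕ → ι → C.BgB}
  {c θ γ₄ C₄ ν β' : ℝ} {Λ₄ : ℕ → ℕ → ℝ}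

/-- **THE TERM-WISE SPINE ROAD END TO END — EXISTENCE (print-faithful form).**  For a finite-`ε` datum `D` with measurable averaging maps:
N16 `NE3Shape R C₃ θ₃` + liaison, N17 `NE4OnData D c θ γ₄` + node U2's history moduli + the printed-type `BetaUpperH β′ γ₄ D.βfun` (`γ₄²β′ < 1`),
N18 `NE5`, N22 `NE9 ∧ FadingMemory`, `LipBackground`, `hWin`; and, under the prefix `D.UnderHypotheses (DagBinding.EndpointExistence D.C.toB12)`,
per string the ∃-package N20 `RelWeightBound` · N21 `ShellWeightBound` · E1∕E2 vs `schemeZ (D.scheme g₀) os (K₀ + K)` · `PolyLipGrowth` · N19's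
Link `LedgerAt` at the clamped run tables ⇒ **`D.ym4_torus_continuum_limit_exists'`** — `hybridNE7Under_of_declColumns_tail` (IX §3) at
`Hβ := END`, then `T4ApexHybrid.limit_exists'_of_hybridNE7Under'`.  CONDITIONAL on every binder ((B) pinned and END are antecedents INSIDE the
target); ONE finite torus; NOT ℝ⁴ ∕ OS ∕ mass gap ∕ Clay. [bookkeeping] [folklore] -/
theorem limit_exists'_of_declColumns_tail (D : FiniteEpsData F G) (hM : D.AvgMeasurable)
    (h16 : NE3Shape R C₃ θ₃) (hC₃ : 0 ≤ C₃) (hgd : GaugeDominated R uA uB)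
    (h17 : NE4OnData D c θ γ₄) (hL4 : HistLipschitz Λ₄ γ₄ D.βfun) (hΛ4 : FadingMemory C₄ ν Λ₄)
    (hc : 0 ≤ c) (hC₄ : 0 ≤ C₄) (hν0 : 0 ≤ ν) (hνθ : ν < θ) (hθ1 : θ < 1) (hγ₄ : 0 < γ₄)
    (hhi : BetaUpperH β' γ₄ D.βfun) (hγβ : γ₄ ^ 2 * β' < 1)
    (h18 : NE5 EA EB Wset κ θ₅ C₅) (hθ₅ : 0 ≤ θ₅) (hC₅ : 0 ≤ C₅)
    (h22 : NE9 EA Wset κ Λm ∧ FadingMemory C₉ ω Λm) (hω : 0 ≤ ω)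
    (hUL : LipBackground EA Wset κ CU) (hP : 0 ≤ P) (hγu : 0 < γu) (hWin : Window γu ⊆ Wset)
    (hPkg : D.UnderHypotheses (DagBinding.EndpointExistence D.C.toB12) fun g₀ => ∀ os : List (ULoop F),
      ∃ (σ : Type) (_ : DecidableEq σ) (L : LedgerData C ι σ) (l₀ vol : ℝ) (K₀ : ℕ) (T : ℕ → Finset σ)
        (Bad : ℕ → ℝ → Finset σ) (A B shA shB : ℕ → ℝ → σ → ℝ) (W Wsh : ℕ → ℝ),
        0 < l₀ ∧ 0 < vol ∧ RelWeightBound l₀ T A B Bad W ∧ ShellWeightBound l₀ T A B shA shB Wsh ∧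
        (∀ (K : ℕ) (t : ℝ), |t| ≤ l₀ → T4GenFunBounds.schemeZ (D.scheme g₀) os (K₀ + K) t = ∑ τ ∈ T K, A K t τ) ∧
        (∀ (K : ℕ) (t : ℝ), |t| ≤ l₀ → T4GenFunBounds.schemeZ (D.scheme g₀) os (K₀ + K + 1) t = ∑ τ ∈ T K, B K t τ) ∧
        PolyLipGrowth CU (fun K => extd (prefixOf (runFlow D g₀ (K₀ + K)) (K₀ + K))) P q ∧
        LedgerAt L l₀ vol T Bad (fun K t τ => A K t τ - shA K t τ) (fun K t τ => B K t τ - shB K t τ) R EA EB κ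
          (fun K => extd (prefixOf (runFlow D g₀ (K₀ + K)) (K₀ + K))) uA uB ω θ θ₅ θ₃) :
    D.ym4_torus_continuum_limit_exists' :=
  T4ApexHybrid.limit_exists'_of_hybridNE7Under' D hM
    (hybridNE7Under_of_declColumns_tail D h16 hC₃ hgd h17 hL4 hΛ4 hc hC₄ hν0 hνθ hθ1 hγ₄ hhi hγβ h18 hθ₅ hC₅ h22 hω hUL
      hP hγu hWin hPkg)

end Existence

/-! ## §2 (0.4)-data on `SU(N)`: all four print-faithful targets -/

section SU

variable {F : T4Family} {N : ℕ} [NeZero N] {ℰ : LoopAverage (Matrix.specialUnitaryGroup (Fin N) ℂ)}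
  {C : Carriers} {ι X : Type} [MeasurableSpace ι]
  {R : Readings ι X} {Wset : Set (ℕ → ℝ)} {EA : Functional C C.BgA} {EB : Functional C C.BgB}
  {κ θ₅ C₅ C₉ ω C₃ θ₃ P γu : ℝ} {q : ℕ} {Λm : ℕ → ℕ → ℝ} {CU : (ℕ → ℝ) → ℕ → ℝ}
  {uA : ℕ → ι → C.BgA} {uB : ℕ → ι → C.BgB}
  {c θ γ₄ C₄ ν β' : ℝ} {Λ₄ : ℕ → ℕ → ℝ}

/-- **THE TERM-WISE SPINE ROAD END TO END — THE FOUR PRINT-FAITHFUL TARGETS ON `SU(N)`.**  For (0.4)-data `D` on `SU(N)` whose small-field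
average IS Bałaban's block average over a measurable small-loop average `ℰ` (`D.IsBlockAveraged ℰ`, `ℰ.MeasurableE`): §1's hypotheses ⇒
`D.ym4_torus_continuum_limit_exists' ∧ D.ym4_torus_continuum_limit_unique' ∧ D.limit_reflectionPositive' ∧ D.limit_torusCovariant'` —
`hybridNE7Under_of_declColumns_tail` at `Hβ := END`, then `T4ApexHybrid.targets'_of_hybridNE7Under'`.  CONDITIONAL on every binder; ONE
finite torus; NOT ℝ⁴ ∕ OS ∕ mass gap ∕ Clay. [bookkeeping] [folklore] -/
theorem targets'_of_declColumns_tail {D : FiniteEpsData F (Matrix.specialUnitaryGroup (Fin N) ℂ)}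
    (hD : D.IsBlockAveraged ℰ) (hE : ℰ.MeasurableE)
    (h16 : NE3Shape R C₃ θ₃) (hC₃ : 0 ≤ C₃) (hgd : GaugeDominated R uA uB)
    (h17 : NE4OnData D c θ γ₄) (hL4 : HistLipschitz Λ₄ γ₄ D.βfun) (hΛ4 : FadingMemory C₄ ν Λ₄)
    (hc : 0 ≤ c) (hC₄ : 0 ≤ C₄) (hν0 : 0 ≤ ν) (hνθ : ν < θ) (hθ1 : θ < 1) (hγ₄ : 0 < γ₄)
    (hhi : BetaUpperH β' γ₄ D.βfun) (hγβ : γ₄ ^ 2 * β' < 1)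
    (h18 : NE5 EA EB Wset κ θ₅ C₅) (hθ₅ : 0 ≤ θ₅) (hC₅ : 0 ≤ C₅)
    (h22 : NE9 EA Wset κ Λm ∧ FadingMemory C₉ ω Λm) (hω : 0 ≤ ω)
    (hUL : LipBackground EA Wset κ CU) (hP : 0 ≤ P) (hγu : 0 < γu) (hWin : Window γu ⊆ Wset)
    (hPkg : D.UnderHypotheses (DagBinding.EndpointExistence D.C.toB12) fun g₀ => ∀ os : List (ULoop F),
      ∃ (σ : Type) (_ : DecidableEq σ) (L : LedgerData C ι σ) (l₀ vol : ℝ) (K₀ : ℕ) (T : ℕ → Finset σ)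
        (Bad : ℕ → ℝ → Finset σ) (A B shA shB : ℕ → ℝ → σ → ℝ) (W Wsh : ℕ → ℝ),
        0 < l₀ ∧ 0 < vol ∧ RelWeightBound l₀ T A B Bad W ∧ ShellWeightBound l₀ T A B shA shB Wsh ∧
        (∀ (K : ℕ) (t : ℝ), |t| ≤ l₀ → T4GenFunBounds.schemeZ (D.scheme g₀) os (K₀ + K) t = ∑ τ ∈ T K, A K t τ) ∧
        (∀ (K : ℕ) (t : ℝ), |t| ≤ l₀ → T4GenFunBounds.schemeZ (D.scheme g₀) os (K₀ + K + 1) t = ∑ τ ∈ T K, B K t τ) ∧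
        PolyLipGrowth CU (fun K => extd (prefixOf (runFlow D g₀ (K₀ + K)) (K₀ + K))) P q ∧
        LedgerAt L l₀ vol T Bad (fun K t τ => A K t τ - shA K t τ) (fun K t τ => B K t τ - shB K t τ) R EA EB κ
          (fun K => extd (prefixOf (runFlow D g₀ (K₀ + K)) (K₀ + K))) uA uB ω θ θ₅ θ₃) :
    D.ym4_torus_continuum_limit_exists' ∧ D.ym4_torus_continuum_limit_unique' ∧
      D.limit_reflectionPositive' ∧ D.limit_torusCovariant' :=
  T4ApexHybrid.targets'_of_hybridNE7Under' hD hE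
    (hybridNE7Under_of_declColumns_tail D h16 hC₃ hgd h17 hL4 hΛ4 hc hC₄ hν0 hνθ hθ1 hγ₄ hhi hγβ h18 hθ₅ hC₅ h22 hω hUL
      hP hγu hWin hPkg)

end SU

end Summit.QuantumFields.YangMills.Theorems.BalabanUVNodesN27SpineRecord
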